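import Mathlib
import Literature.Combinatorics.Additive.TripleProductProperty

/-!
# Ideator 4 (round 2) — crux `stmt-MatrixMultiplication-10882` (`SnSubsetDichotomy.ThresholdSubsetTriples`)

Two small, sorry-free lemmas recorded with the round-2 barrier notes (`Ideator4-r2-BarrierNotes.md`, note B4):

* `tpp_of_twoHosted_oneFree` — the DECOUPLING CRITERION: if `S ⊆ H₁`, `T ⊆ H₂` (subgroups),
  `Q(T) ∩ H₁ = 1` and `Q(U) ∩ H₁H₂ = 1`, then `(S, T, U)` has the TPP.  It discharges the genuinely three-fold
  condition by a ONE-SET code condition on `U` (an independent set of the Cayley graph of the product set `H₁H₂`).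
* `tpp_subgroupMember_of_twoHosted_oneFree` — the same hypotheses make `(H₁, T, U)` a TPP triple with a WHOLE
  SUBGROUP as a member, so the tree's subgroup-pivot sieve (`Negative/SubgroupMemberFalse`, `conceded_subgroup_cap`)
  caps `|H₁||T||U| ≤ n!·d_max(S_n)`; since `|S| ≤ |H₁|`, every triple certified by the decoupling criterion is
  sub-threshold for `c < c₂/2`.  The decoupled form of "two hosted, one free" is therefore dead for `X`.
-/

namespace Summit.MatrixMultiplication.MatrixMultiplication.Cruxes.ThresholdSubsetTriples.Ideator4

open Literature.Combinatorics.Additive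

variable {G : Type*} [Group G] [DecidableEq G]

/-- **Decoupling criterion ("two hosted, one free").**  `S ⊆ H₁`, `T ⊆ H₂`, the pair condition
`Q(T) ∩ H₁ = {1}` and the one-set code condition `Q(U) ∩ H₁H₂ = {1}` imply the triple product property. -/
theorem tpp_of_twoHosted_oneFree (H₁ H₂ : Subgroup G) {S T U : Finset G}
    (hS : ∀ s ∈ S, s ∈ H₁) (hT : ∀ t ∈ T, t ∈ H₂)
    (hpair : ∀ t ∈ T, ∀ t' ∈ T, t * t'⁻¹ ∈ H₁ → t = t')
    (hcode : ∀ u ∈ U, ∀ u' ∈ U, ∀ a ∈ H₁, ∀ b ∈ H₂, u * u'⁻¹ = a * b → u = u') :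
    TripleProductProperty S T U := by
  intro s hs s' hs' t ht t' ht' u hu u' hu' h
  have ha : s * s'⁻¹ ∈ H₁ := H₁.mul_mem (hS s hs) (H₁.inv_mem (hS s' hs'))
  have hb : t * t'⁻¹ ∈ H₂ := H₂.mul_mem (hT t ht) (H₂.inv_mem (hT t' ht'))
  -- `a b = (u u'⁻¹)⁻¹ = u' u⁻¹`, so the code condition gives `u' = u`
  have hab : s * s'⁻¹ * (t * t'⁻¹) = (u * u'⁻¹)⁻¹ := mul_eq_one_iff_eq_inv.mp h
  have hc : u' * u⁻¹ = s * s'⁻¹ * (t * t'⁻¹) := by rw [hab, mul_inv_rev, inv_inv]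
  have hu_eq : u' = u := hcode u' hu' u hu _ ha _ hb hc
  subst hu_eq
  -- hence `a b = 1`, `b = a⁻¹ ∈ H₁`, the pair condition gives `t = t'`, then `a = 1`
  have hab1 : s * s'⁻¹ * (t * t'⁻¹) = 1 := by simpa using hab
  have hb1 : t * t'⁻¹ = (s * s'⁻¹)⁻¹ := eq_inv_of_mul_eq_one_right hab1
  have hbH : t * t'⁻¹ ∈ H₁ := by rw [hb1]; exact H₁.inv_mem ha
  have ht_eq : t = t' := hpair t ht t' ht' hbH
  subst ht_eq
  have ha1 : s * s'⁻¹ = 1 := by simpa using hab1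
  exact ⟨mul_inv_eq_one.mp ha1, rfl, rfl⟩

/-- **The decoupled form concedes a whole subgroup.**  Under the same hypotheses the triple
`(H₁, T, U)` — with the subgroup `H₁` itself as first member — also has the TPP; so the subgroup-pivot sieve of the
tree applies to every triple certified by `tpp_of_twoHosted_oneFree`. -/
theorem tpp_subgroupMember_of_twoHosted_oneFree [Fintype G] (H₁ H₂ : Subgroup G) [DecidablePred (· ∈ H₁)]
    {T U : Finset G} (hT : ∀ t ∈ T, t ∈ H₂)
    (hpair : ∀ t ∈ T, ∀ t' ∈ T, t * t'⁻¹ ∈ H₁ → t = t')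
    (hcode : ∀ u ∈ U, ∀ u' ∈ U, ∀ a ∈ H₁, ∀ b ∈ H₂, u * u'⁻¹ = a * b → u = u') :
    TripleProductProperty (Finset.univ.filter (· ∈ H₁)) T U :=
  tpp_of_twoHosted_oneFree H₁ H₂ (fun s hs => (Finset.mem_filter.mp hs).2) hT hpair hcode

end Summit.MatrixMultiplication.MatrixMultiplication.Cruxes.ThresholdSubsetTriples.Ideator4
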